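import Literature.MathematicalPhysics.QuantumFieldTheory.Balaban1983to89.B1Eq324BenfattoSect5FreeCumulants
import Literature.MathematicalPhysics.QuantumFieldTheory.Balaban1983to89.B1Eq324BenfattoSect5TupleClustersDecay
import Literature.MathematicalPhysics.QuantumFieldTheory.Balaban1983to89.B1Eq324BenfattoSect5AnchoredColourings
import Literature.MathematicalPhysics.QuantumFieldTheory.Balaban1983to89.B1Eq324BenfattoSect5Boxes
import HarnessLib

/-!
# `Balaban1983to89.B1Eq324BenfattoSect5FreeStepCross` — [BenfattoEtAl1978] §5 p. 159 «Collecting all the errors made in this process»: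
# the CROSS colourings of one pavement step are bounded, EXTENSIVELY in the boxes, by Appendix D under `P̂₀` with the decay
# distributed over the slots — the structural bound (decay-weighted class masses displayed), PROVED

statement-level skeleton of published theorems with citation tags; proofs where landed; nothing here is a claim about the
Yang–Mills mass gap

WHY THIS MODULE (cell `pub-ymgap`, seat `dag-n08-b`, node N08; item (R1) of the `BasicLemmaPrinted` assembly map; sequel of
`…Sect5FreeStep`).  `…Sect5FreeStep.sum_truncatedExp_sub_eq_telescope` leaves, per pavement step and order, the CROSS sum of
`…Sect5FreeCumulants.cumulantOf_telescope_eq_sum_local_add_cross`: the free Ursell functions of the colourings of `k+1` slots by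
the palette `none ↦` (rest class), `(m,false) ↦` (box `m`'s shallow class), `(m,true) ↦` (box `m`'s deep class `Ψ″₁(m)`) that use
some deep colour `(m,true)` but are not painted inside one box.  `…FreeCumulants.abs_sum_cross_le_sum_anchored` files them by an
ANCHOR box `m` (a slot coloured `Ψ″₁(m)`); for an anchored colouring the sibling seat's
`…TupleClustersDecay.abs_ursellOf_tupleSums_condField_le_prod_decayMass` (Appendix D with «max ≥ mean») bounds the Ursell function by
`2^{nD}2^{2^{nD}}K₀^{nD}` times the product over the slots of the class masses DECAY-WEIGHTED from the anchor's deep region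
`□′_m∖Γ₄(□_m) = shrink L m (2w+v)` (every `Ψ″₁(m)`-tuple meets it), and the sibling seat's counting
`…AnchoredColourings` counting, here with TWO pinned slots (the anchor AND the far slot every cross colouring has — a colour outside
box `m`'s two), sums the products: `≤ (k+1)k·W_m(m,true)·W^far_m·(Σ_c W_m(c))^{k−1}`, the far mass `W^far_m` carrying the decay
`e^{−(δ/(2(k+1)))·dist}` from `□′_m∖Γ₄(□_m)`.  Summing over the anchors gives the structural extensive bound ★ `abs_cross_le_sum_anchor`;
the evaluation of the decay-weighted masses `W_m(c)` by lattice sums (`…SlotMasses.weightedMass_le_card_mul`,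
`…CrossCount.sum_exp_neg_mul_l1_le`: the rest class is volume-size but decay-weighted from the anchor, hence `O(1)`; the other
boxes' classes carry `e^{−(δ/(2(k+1)))·dist}`) is the next edition.

DICTIONARY.  Palette `Option (↥B × Bool)` and CROSS / anchored filters as in `…Sect5FreeCumulants`; classes `cls c` of the palette
colours (tuple classes over `J`; the consumer takes `cls none = tuplesIn J · Γ₁`, `cls (m,false) =` the `Ψ′₁(m)`- and `Ψ₂(m)`-classes,
`cls (m,true) =` the `Ψ″₁(m)`-class of `…Sect5PerBoxOnData`); `hdeep`: every tuple of `cls (m,true)` meets `shrink L m (2w+v)`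
(`…Sect5Eq524.exists_mem_core_sdiff_frame4`); `ρ m : Q₀ → ℝ` any length with `ρ m y ≤ ℓ¹(x,y)` for `x` in that region (e.g. the
`ℓ¹`-distance to it); `K₀ = max(1, C₀₀)` (under `P̂₀` the conditioned mean vanishes); `W_m(c)` = the mass of `cls c` weighted by
`e^{(δ/2)D²(√d·d(Δ)+d)}·e^{−(δ/(2(k+1)))ρ_m(Δ₀)}`, `Δ₀` the anchor tessera.

WHAT IS PROVED (theorems only; no definition, no named fact, no `sorry`; axioms standard).
* `abs_ursellOf_le_of_anchored` — one colouring using `(m,true)`: `|𝓔^T_0(f)| ≤ 2^{(k+1)D}2^{2^{(k+1)D}}K₀^{(k+1)D}·Π_j W_m(f j)`.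
* `sum_filter_two_pins_eq_prod` (two pinned slots: `= w(c₀)·(Σ_{c∈S}w c)·(Σ_c w c)^{n−2}`), `sum_anchored_prod_le` (anchored cross
  colourings: `≤ (k+1)k·w(m,true)·w_far·(Σ_c w c)^{k−1}`); private `sum_biUnion_le_sum_sum`.
* ★ **`abs_cross_le_sum_anchor`** — `|CROSS_{k+1}| ≤ 2^{(k+1)D}2^{2^{(k+1)D}}K₀^{(k+1)D}·Σ_m (k+1)k·W_m(m,true)·W^far_m·(Σ_c W_m(c))^{k−1}`.

HONEST SCOPE / NOT HERE.  The lattice-sum evaluation of `W_m(c)` (uniform `O(1)` per anchor), the same treatment of the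
within-box `W₂₉` sums and of the `Ψ₃` / (5.34) corrections, and the assembly are NOT here.  `BasicLemmaPrinted` stays OPEN.  NOT
summit progress; count-neutral for N08; nothing of [Balaban1985UV3] (41)/(47)/(5) is asserted.
-/

open MeasureTheory ProbabilityTheory Finset
open scoped BigOperators Nat

namespace Literature.MathematicalPhysics.QuantumFieldTheory.Balaban1983to89.B1Eq324BenfattoSect5FreeStepCross

open _root_.MeasureTheory _root_.ProbabilityTheory
open Literature.Probability.LatticeModels (ursellOf)
open Literature.MathematicalPhysics.QuantumFieldTheory
open Literature.MathematicalPhysics.QuantumFieldTheory.Balaban1983to89.B1Eq324BenfattoLemma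
open Literature.MathematicalPhysics.QuantumFieldTheory.Balaban1983to89.B1Eq324BenfattoSect5Boxes
open Literature.MathematicalPhysics.QuantumFieldTheory.Balaban1983to89.B1Eq324BenfattoSect5Eq511 (term)
open Literature.MathematicalPhysics.QuantumFieldTheory.Balaban1983to89.B1Eq324BenfattoAppendixC2 (freeCov_nonneg)
open Literature.MathematicalPhysics.QuantumFieldTheory.Balaban1983to89.B1Eq324BenfattoSect5FreeCumulants (abs_sum_cross_le_sum_anchored)
open Literature.MathematicalPhysics.QuantumFieldTheory.Balaban1983to89.B1Eq324BenfattoSect5TupleClustersDecay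
  (abs_ursellOf_tupleSums_condField_le_prod_decayMass)
open Literature.MathematicalPhysics.QuantumFieldTheory.Balaban1983to89.B1Eq324BenfattoSect5AnchoredColourings
  (sum_filter_exists_apply_eq_prod_le)

variable {d : ℕ}

section Cross

variable {α β : ℝ} {s D : ℕ} {κ : ℝ} {a : Coef d} {J : Finset (B1Eq324BenfattoLemma.Site d)} {L w v : ℕ}
  {B : Finset (B1Eq324BenfattoLemma.Site d)}

/-- **ONE ANCHORED COLOURING** (Appendix D under `P̂₀`, decay distributed over the slots): for a colouring `f` of `k+1` slots with a
slot painted `(m, true)` — the deep class of box `m`, every tuple of which meets `shrink L m (2w+v)` —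
`|𝓔^T_0(f)| ≤ 2^{(k+1)D}·2^{2^{(k+1)D}}·K₀^{(k+1)D}·Π_j W_m(f j)`, `K₀ = max(1, C₀₀)`.
[cite: BenfattoEtAl1978, Appendix D p.166 and §5 p.159] -/
theorem abs_ursellOf_le_of_anchored (hα : 0 < α) (hβ : 0 < β) (hd : 0 < d)
    (cls : Option (↥B × Bool) → (p : ℕ) → Finset (Fin p → J))
    (hdeep : ∀ m : ↥B, ∀ p ∈ Finset.Icc 1 s, ∀ Δ ∈ cls (some (m, true)) p,
      ∃ i, (Δ i : B1Eq324BenfattoLemma.Site d) ∈ shrink L (m : B1Eq324BenfattoLemma.Site d) (2 * w + v))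
    {δ : ℝ} (hδ : 0 ≤ δ) (hδle : δ ≤ Real.log ((2 * d + α ^ 2) / (2 * d)))
    (ρ : ↥B → B1Eq324BenfattoLemma.Site d → ℝ)
    (hρ : ∀ m : ↥B, ∀ x ∈ shrink L (m : B1Eq324BenfattoLemma.Site d) (2 * w + v), ∀ y,
      ρ m y ≤ ∑ j, |((x j : ℝ) - (y j : ℝ))|)
    {k : ℕ} (m : ↥B) {f : Fin (k + 1) → Option (↥B × Bool)} (hf : ∃ j, f j = some (m, true)) :
    |ursellOf (fun P : Finset (Fin (k + 1)) => ∫ z, ∏ j ∈ P,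
        (∑ p ∈ Finset.Icc 1 s, ∑ Δ ∈ cls (f j) p, ∑ n ∈ admissible p D, term κ a z p Δ n) ∂P0 d α β) univ| ≤
      2 ^ ((k + 1) * D) * 2 ^ 2 ^ ((k + 1) * D) * (max 1 (freeCov d α β 0 0)) ^ ((k + 1) * D) *
        ∏ j, ∑ p ∈ Finset.Icc 1 s, ∑ Δ ∈ cls (f j) p, ∑ n ∈ admissible p D,
          |a p (fun i => (Δ i : B1Eq324BenfattoLemma.Site d)) n| *
            Real.exp (-(κ / 2) * connLength fun i => (Δ i : B1Eq324BenfattoLemma.Site d)) *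
            (Real.exp (δ / 2 * ((D : ℝ) ^ 2 * (Real.sqrt d * connLength (fun i => (Δ i : B1Eq324BenfattoLemma.Site d)) + d))) *
              Real.exp (-(δ / (2 * ((k + 1 : ℕ) : ℝ)) *
                ρ m (if h : 0 < p then (Δ ⟨0, h⟩ : B1Eq324BenfattoLemma.Site d) else (0 : B1Eq324BenfattoLemma.Site d))))) := by
  obtain ⟨j₁, hj₁⟩ := hf
  have h := abs_ursellOf_tupleSums_condField_le_prod_decayMass (σ := Fin (k + 1)) (s := s) (D := D) (ϰ := κ) (a := a)
    hα hβ hd ∅ (fun _ => 0) (fun j => cls (f j)) (le_max_left 1 (freeCov d α β 0 0)) (le_max_right 1 (freeCov d α β 0 0))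
    (fun j p _ Δ _ i => by
      rw [condMean_empty, abs_zero]
      exact zero_le_one.trans (le_max_left _ _))
    hδ hδle j₁ (shrink L (m : B1Eq324BenfattoLemma.Site d) (2 * w + v) : Set (B1Eq324BenfattoLemma.Site d))
    (fun p hp Δ hΔ => by
      rw [hj₁] at hΔ
      obtain ⟨i, hi⟩ := hdeep m p hp Δ hΔ
      exact ⟨i, Finset.mem_coe.2 hi⟩)
    (ρ m) (fun x hx y => hρ m x (Finset.mem_coe.1 hx) y)
  rw [condField_empty, Fintype.card_fin] at h
  exact h

/-- Sums over a union of index sets are at most the sum of the sums (nonnegative terms). [folklore] -/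
private theorem sum_biUnion_le_sum_sum {ι τ : Type*} [DecidableEq τ] (T : Finset ι) (Bf : ι → Finset τ) (W : τ → ℝ)
    (hW : ∀ b, 0 ≤ W b) : ∑ b ∈ T.biUnion Bf, W b ≤ ∑ a ∈ T, ∑ b ∈ Bf a, W b := by
  classical
  induction T using Finset.induction_on with
  | empty => simp
  | insert a T ha ih =>
    rw [Finset.biUnion_insert, Finset.sum_insert ha]
    have hu : ∑ b ∈ Bf a ∪ T.biUnion Bf, W b ≤ ∑ b ∈ Bf a, W b + ∑ b ∈ T.biUnion Bf, W b := by
      rw [← Finset.sum_union_inter]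
      have : 0 ≤ ∑ b ∈ Bf a ∩ T.biUnion Bf, W b := Finset.sum_nonneg fun b _ => hW b
      linarith
    linarith

/-- **TWO PINNED SLOTS**: the colourings of `n` slots with slot `j₁` painted `c₀` and slot `j₂ ≠ j₁` painted in `S` carry total
product weight `w(c₀)·(Σ_{c∈S} w c)·(Σ_c w c)^{n−2}` (`Fintype.piFinset` + `Finset.prod_univ_sum`; the one-pin case is the sibling
seat's `…AnchoredColourings.sum_filter_apply_eq_prod_eq`). [cite: BenfattoEtAl1978, §5 p.159] -/
theorem sum_filter_two_pins_eq_prod {P : Type*} [Fintype P] [DecidableEq P] {n : ℕ} (w : P → ℝ) (c₀ : P) (S : Finset P)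
    {j₁ j₂ : Fin n} (hj : j₁ ≠ j₂) :
    ∑ f ∈ (Finset.univ : Finset (Fin n → P)).filter (fun f => f j₁ = c₀ ∧ f j₂ ∈ S), ∏ i, w (f i) =
      w c₀ * (∑ c ∈ S, w c) * (∑ c, w c) ^ (n - 2) := by
  classical
  set t : Fin n → Finset P := fun i => if i = j₁ then {c₀} else if i = j₂ then S else Finset.univ with ht
  have hfilter : (Finset.univ : Finset (Fin n → P)).filter (fun f => f j₁ = c₀ ∧ f j₂ ∈ S) = Fintype.piFinset t := by
    ext f
    simp only [Finset.mem_filter, Finset.mem_univ, true_and, Fintype.mem_piFinset, ht]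
    constructor
    · rintro ⟨h1, h2⟩ i
      by_cases hi1 : i = j₁
      · subst hi1; rw [if_pos rfl, Finset.mem_singleton]; exact h1
      · rw [if_neg hi1]
        by_cases hi2 : i = j₂
        · subst hi2; rw [if_pos rfl]; exact h2
        · rw [if_neg hi2]; exact Finset.mem_univ _
    · intro hf
      have h1 := hf j₁
      have h2 := hf j₂
      rw [if_pos rfl, Finset.mem_singleton] at h1
      rw [if_neg hj.symm, if_pos rfl] at h2
      exact ⟨h1, h2⟩
  have hj₂ : j₂ ∈ (Finset.univ : Finset (Fin n)).erase j₁ := Finset.mem_erase.2 ⟨hj.symm, Finset.mem_univ _⟩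
  rw [hfilter, ← Finset.prod_univ_sum t (fun _ c => w c), ← Finset.mul_prod_erase Finset.univ _ (Finset.mem_univ j₁),
    ← Finset.mul_prod_erase _ _ hj₂]
  have e1 : ∑ c ∈ t j₁, w c = w c₀ := by simp [ht]
  have e2 : ∑ c ∈ t j₂, w c = ∑ c ∈ S, w c := by simp [ht, hj.symm]
  have e3 : ∏ i ∈ ((Finset.univ : Finset (Fin n)).erase j₁).erase j₂, ∑ c ∈ t i, w c = (∑ c, w c) ^ (n - 2) := by
    rw [Finset.prod_congr rfl (g := fun _ => ∑ c, w c) ?_]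
    · rw [Finset.prod_const, Finset.card_erase_of_mem hj₂, Finset.card_erase_of_mem (Finset.mem_univ j₁), Finset.card_univ,
        Fintype.card_fin, Nat.sub_sub]
    · intro i hi
      have hi2 : i ≠ j₂ := Finset.ne_of_mem_erase hi
      have hi1 : i ≠ j₁ := Finset.ne_of_mem_erase (Finset.mem_of_mem_erase hi)
      simp [ht, hi1, hi2]
  rw [e1, e2, e3, mul_assoc]

/-- **THE ANCHORED CROSS COLOURINGS CARRY A FAR SLOT**: for non-negative weights, the colourings of `k+1` slots using `(m, true)` AND
a colour outside box `m`'s two colours have total product weight `≤ (k+1)·k·w(m,true)·w_far·(Σ_c w c)^{k−1}`,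
`w_far = Σ_{c ∉ {(m,false),(m,true)}} w c` (union bound over the two pinned slots, `sum_filter_two_pins_eq_prod`).
[cite: BenfattoEtAl1978, §5 p.159] -/
theorem sum_anchored_prod_le {M : Type*} [Fintype M] [DecidableEq M] {k : ℕ} (w : Option (M × Bool) → ℝ) (hw : ∀ c, 0 ≤ w c)
    (m : M) :
    ∑ f ∈ univ.filter (fun f : Fin (k + 1) → Option (M × Bool) =>
          (∃ j, f j = some (m, true)) ∧ ∃ j, ¬(f j = some (m, false) ∨ f j = some (m, true))), ∏ i, w (f i) ≤
      ((k + 1 : ℕ) : ℝ) * (k : ℝ) * (w (some (m, true)) *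
        (∑ c ∈ (univ.erase (some (m, false))).erase (some (m, true)), w c) * (∑ c, w c) ^ (k - 1)) := by
  classical
  set S : Finset (Option (M × Bool)) := (univ.erase (some (m, false))).erase (some (m, true)) with hS
  have hsub : univ.filter (fun f : Fin (k + 1) → Option (M × Bool) =>
        (∃ j, f j = some (m, true)) ∧ ∃ j, ¬(f j = some (m, false) ∨ f j = some (m, true))) ⊆
      (univ : Finset (Fin (k + 1))).biUnion fun j₁ => ((univ : Finset (Fin (k + 1))).erase j₁).biUnion fun j₂ =>
        (Finset.univ : Finset (Fin (k + 1) → Option (M × Bool))).filter (fun f => f j₁ = some (m, true) ∧ f j₂ ∈ S) := by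
    intro f hf
    simp only [Finset.mem_filter, Finset.mem_univ, true_and, Finset.mem_biUnion, Finset.mem_erase] at hf ⊢
    obtain ⟨⟨j₁, hj₁⟩, j₂, hj₂⟩ := hf
    refine ⟨j₁, j₂, ⟨fun h => hj₂ (Or.inr (h ▸ hj₁)), trivial⟩, hj₁, ?_⟩
    rw [hS, Finset.mem_erase, Finset.mem_erase]
    exact ⟨fun h => hj₂ (Or.inr h), fun h => hj₂ (Or.inl h), Finset.mem_univ _⟩
  have hnn : ∀ f : Fin (k + 1) → Option (M × Bool), 0 ≤ ∏ i, w (f i) := fun f => Finset.prod_nonneg fun i _ => hw _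
  refine (Finset.sum_le_sum_of_subset_of_nonneg hsub fun f _ _ => hnn f).trans ?_
  refine (sum_biUnion_le_sum_sum _ _ _ hnn).trans ?_
  have hk2 : k + 1 - 2 = k - 1 := by omega
  have hinner : ∀ j₁ : Fin (k + 1),
      ∑ f ∈ ((univ : Finset (Fin (k + 1))).erase j₁).biUnion (fun j₂ =>
          (Finset.univ : Finset (Fin (k + 1) → Option (M × Bool))).filter (fun f => f j₁ = some (m, true) ∧ f j₂ ∈ S)),
        ∏ i, w (f i) ≤
        (k : ℝ) * (w (some (m, true)) * (∑ c ∈ S, w c) * (∑ c, w c) ^ (k - 1)) := by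
    intro j₁
    refine (sum_biUnion_le_sum_sum _ _ _ hnn).trans (le_of_eq ?_)
    rw [Finset.sum_congr rfl (fun j₂ hj₂ => sum_filter_two_pins_eq_prod w (some (m, true)) S
      (Finset.ne_of_mem_erase hj₂).symm), Finset.sum_const, nsmul_eq_mul, Finset.card_erase_of_mem (Finset.mem_univ j₁),
      Finset.card_univ, Fintype.card_fin, Nat.add_sub_cancel, hk2]
  refine (Finset.sum_le_sum fun j₁ _ => hinner j₁).trans (le_of_eq ?_)
  rw [Finset.sum_const, nsmul_eq_mul, Finset.card_univ, Fintype.card_fin]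
  ring

/-- **THE CROSS COLOURINGS OF ONE PAVEMENT STEP, EXTENSIVE IN THE BOXES** (structural form): with the palette classes `cls`, the deep
classes meeting `shrink L m (2w+v)`, and the anchored decay-weighted masses `W_m(c)`,
`|CROSS_{k+1}| ≤ 2^{(k+1)D}·2^{2^{(k+1)D}}·K₀^{(k+1)D}·Σ_m (k+1)k·W_m(m,true)·W^far_m·(Σ_c W_m(c))^{k−1}`, where
`W^far_m = Σ_{c ∉ {(m,false),(m,true)}} W_m(c)` carries the decay from `□′_m∖Γ₄(□_m)` to the far slot every cross colouring has
(`…FreeCumulants.abs_sum_cross_le_sum_anchored`, `abs_ursellOf_le_of_anchored`, `sum_anchored_prod_le`).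
[cite: BenfattoEtAl1978, §5 p.159 and Appendix D p.166] -/
theorem abs_cross_le_sum_anchor (hα : 0 < α) (hβ : 0 < β) (hd : 0 < d)
    (cls : Option (↥B × Bool) → (p : ℕ) → Finset (Fin p → J))
    (hdeep : ∀ m : ↥B, ∀ p ∈ Finset.Icc 1 s, ∀ Δ ∈ cls (some (m, true)) p,
      ∃ i, (Δ i : B1Eq324BenfattoLemma.Site d) ∈ shrink L (m : B1Eq324BenfattoLemma.Site d) (2 * w + v))
    {δ : ℝ} (hδ : 0 ≤ δ) (hδle : δ ≤ Real.log ((2 * d + α ^ 2) / (2 * d)))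
    (ρ : ↥B → B1Eq324BenfattoLemma.Site d → ℝ)
    (hρ : ∀ m : ↥B, ∀ x ∈ shrink L (m : B1Eq324BenfattoLemma.Site d) (2 * w + v), ∀ y,
      ρ m y ≤ ∑ j, |((x j : ℝ) - (y j : ℝ))|) (k : ℕ) :
    let W : ↥B → Option (↥B × Bool) → ℝ := fun m c => ∑ p ∈ Finset.Icc 1 s, ∑ Δ ∈ cls c p, ∑ n ∈ admissible p D,
          |a p (fun i => (Δ i : B1Eq324BenfattoLemma.Site d)) n| *
            Real.exp (-(κ / 2) * connLength fun i => (Δ i : B1Eq324BenfattoLemma.Site d)) *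
            (Real.exp (δ / 2 * ((D : ℝ) ^ 2 * (Real.sqrt d * connLength (fun i => (Δ i : B1Eq324BenfattoLemma.Site d)) + d))) *
              Real.exp (-(δ / (2 * ((k + 1 : ℕ) : ℝ)) *
                ρ m (if h : 0 < p then (Δ ⟨0, h⟩ : B1Eq324BenfattoLemma.Site d) else (0 : B1Eq324BenfattoLemma.Site d)))))
    |∑ f ∈ univ.filter (fun f : Fin (k + 1) → Option (↥B × Bool) =>
          (∃ j m, f j = some (m, true)) ∧ ¬∃ m, ∀ j, f j = some (m, false) ∨ f j = some (m, true)),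
        ursellOf (fun P : Finset (Fin (k + 1)) => ∫ z, ∏ j ∈ P,
          (∑ p ∈ Finset.Icc 1 s, ∑ Δ ∈ cls (f j) p, ∑ n ∈ admissible p D, term κ a z p Δ n) ∂P0 d α β) univ| ≤
      2 ^ ((k + 1) * D) * 2 ^ 2 ^ ((k + 1) * D) * (max 1 (freeCov d α β 0 0)) ^ ((k + 1) * D) *
        ∑ m, (((k + 1 : ℕ) : ℝ) * (k : ℝ) * (W m (some (m, true)) *
          (∑ c ∈ (univ.erase (some (m, false))).erase (some (m, true)), W m c) * (∑ c, W m c) ^ (k - 1))) := by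
  intro W
  set C : ℝ := 2 ^ ((k + 1) * D) * 2 ^ 2 ^ ((k + 1) * D) * (max 1 (freeCov d α β 0 0)) ^ ((k + 1) * D) with hC
  have hC0 : 0 ≤ C := by positivity
  have hW0 : ∀ m c, 0 ≤ W m c := fun m c =>
    Finset.sum_nonneg fun p _ => Finset.sum_nonneg fun Δ _ => Finset.sum_nonneg fun n _ =>
      mul_nonneg (mul_nonneg (abs_nonneg _) (Real.exp_pos _).le) (mul_nonneg (Real.exp_pos _).le (Real.exp_pos _).le)
  refine (abs_sum_cross_le_sum_anchored k _).trans ?_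
  rw [Finset.mul_sum]
  refine Finset.sum_le_sum fun m _ => ?_
  -- bound term by term on the anchored filter, then count with the two pinned slots
  have hterm : ∀ f ∈ univ.filter (fun f : Fin (k + 1) → Option (↥B × Bool) =>
        (∃ j, f j = some (m, true)) ∧ ∃ j, ¬(f j = some (m, false) ∨ f j = some (m, true))),
      |ursellOf (fun P : Finset (Fin (k + 1)) => ∫ z, ∏ j ∈ P,
          (∑ p ∈ Finset.Icc 1 s, ∑ Δ ∈ cls (f j) p, ∑ n ∈ admissible p D, term κ a z p Δ n) ∂P0 d α β) univ| ≤
        C * ∏ j, W m (f j) := fun f hf =>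
    abs_ursellOf_le_of_anchored hα hβ hd cls hdeep hδ hδle ρ hρ m (Finset.mem_filter.1 hf).2.1
  refine (Finset.sum_le_sum hterm).trans ?_
  rw [← Finset.mul_sum]
  exact mul_le_mul_of_nonneg_left (sum_anchored_prod_le (W m) (hW0 m) m) hC0

end Cross

end Literature.MathematicalPhysics.QuantumFieldTheory.Balaban1983to89.B1Eq324BenfattoSect5FreeStepCross
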